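import Literature.Probability.Percolation.FullPlaneCNL
import Literature.Probability.Percolation.CLE6Proofs
import Literature.Probability.Percolation.LoopRepresentationProofs
import Literature.Probability.Percolation.OneArmLSW
import Literature.Probability.Percolation.TriLatticeRounding
import Literature.Probability.RandomPlanarGeometry.LoopMatching
import Literature.Probability.LatticeModels.TriangularLatticeProofs
import HarnessLib

/-!
# Microscopic interface loops of both types of critical site percolation on `δ𝕋` are dense

Topic `Literature/Probability/Percolation` (proofs and elementary lattice definitions; no named
fact is introduced). Companion to `FullPlaneCNL.lean`, whose named fact
`exists_isFullPlaneCNLLaw` (F. Camia, C. M. Newman, Comm. Math. Phys. 268 (2006), Thms 1 and 6: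
the full-plane Continuum Nonsimple Loop law, rendered in DKKMO's coupling distance `d_CN`) is the
eventual target, and the site-percolation analogue of `LoopDensity.lean` (isolated vertices of
bond percolation on `ℤ²`). In DKKMO's relation `d_CN(F, F') ≤ ε` (`LoopConfig.IsClose`,
arXiv:2012.11672v2, §1.2) *every* loop of either configuration inside the window, however small,
must be matched by an `ε`-close loop **of the same type** of the other configuration; the loops
of a continuum configuration of diameter `< ε` are matched by density alone, provided the lattice
configuration has, near every point of the window, whole interface loops of *both* types of
diameter `O(δ)` (Camia–Newman 2006, Thm 2 (ii) and §5.2: loops of both orientations around every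
point at all scales; two loops inside a common ball of radius `r` are at distance `d ≤ 2r`,
`UnbasedLoop.udist_le_of_subset_closedBall`). This file proves that lattice input:

* `hexAround x` — **the hexagon walk** around the site `x`: the closed walk of length `6` on the
  honeycomb lattice `hexGraph` through the six faces of `𝕋` at `x`, anticlockwise (the translate
  by `hexAddHom x` of the explicit walk `hexAround₀` around the origin; a cycle,
  `isCycle_hexAround`). Its `k`-th dart crosses the edge from `x` to the neighbour
  `x + hexDir k` with `x` on its left (`triEdgeFaces_hexDir`, from the `decide`d table
  `triFace_hexDir` at the origin and the translation covariance `triFace_add`), so that it is an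
  interface loop of `ω` (`IsSiteInterfaceLoop`, `CLE6.lean`) as soon as `x` is an **isolated
  open site** (`isoOpen x`: `x` open, its six neighbours closed; `isSiteInterfaceLoop_hexAround`),
  and its reversal is an interface loop as soon as `x` is an **isolated closed site**
  (`isSiteInterfaceLoop_reverse_hexAround`). Its trace at mesh `δ` lies in `closedBall (δx) δ`
  (`range_toCurve_hexAround_subset`) and its shoelace sum is `√3 > 0` (`shoelace_hexAround`:
  twice the area of the hexagon of circumradius `1/√3`, computed at the origin and transported by
  the translation invariance of the shoelace sum, `shoelace_map_const_add`), so that it is a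
  member of **type `1`** of the typed configuration `siteLoopConfig δ ω` and its reversal a member
  of **type `0`** (`shoelace_reverse`): `exists_mem_siteLoopConfig_of_isoEvent`.
* Probability: the events `isoEvent i x` are determined by the seven-site star `hexStar x`
  (`determinedBy_isoEvent`), have the same probability at every site (relabelling invariance of
  `P_{1/2}` along `v ↦ x + v`, `real_isoEvent_eq`) and a positive one `c₀` (a cylinder event,
  `exists_pos_le_real_isoEvent`); the stars of the sites `rowSite a j = a + 3j e₀` of a row are
  disjoint, so "no isolated site of colour `i` among the first `N` row sites" has probability
  `≤ (1 - c₀)^N` (`real_iInter_compl_isoEvent_rowSite_le`, disjoint-support independence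
  `sitePercolation_real_iInter_eq_prod`).
* `tendsto_measure_setOf_sparse_siteLoopConfig` — **the density theorem**: for every `R₀` and
  `η > 0`, `P_{1/2}(∃ z ∈ closedBall 0 R₀, ∃ i, no member of type i of siteLoopConfig δ ω has its
  trace inside ball z η) → 0` as `δ → 0⁺`; quantitatively (`measure_setOf_sparse_siteLoopConfig_le`)
  the probability is `≤ |t| · 2 · (1 - c₀)^{⌊η/(8δ)⌋}` for any `η/2`-net `t` of the ball: the
  `⌊η/(8δ)⌋` row sites started at the lattice point nearest to `z' ∈ t`
  (`exists_dist_triMeshPoint_le`) carry their hexagons inside `ball z' (η/2) ⊆ ball z η`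
  (`closedBall_rowSite_subset_ball`); union bound over `t` and the two colours.
* `UnbasedLoop.udist_le_diam_union`, `UnbasedLoop.udist_le_of_subset_closedBall` — the metric
  half of the matching of small loops (DKKMO's `d` is dominated by the based distance).

## References

* F. Camia, C. M. Newman, Comm. Math. Phys. 268 (2006) 1–38, §2 (cluster boundaries as oriented
  loops of the hexagonal lattice), Thm 2 (ii), §5.2 [CamiaNewman2006].
* H. Duminil-Copin, K. K. Kozlowski, D. Krachun, I. Manolescu, M. Oulamara, arXiv:2012.11672v2
  (2026), §1.2 (the space `C`, types `F₀ ⊔ F₁`, the distance `d` and the relation `d_CN ≤ ε`)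
  [arXiv201211672v2].
* G. Grimmett, *Percolation*, 2nd ed. (1999), §1.6 Fig. 1.7 (the hexagonal dual of `𝕋`), §2.2
  (events determined by finitely many sites; product measure) [Grimmett1999].
-/

noncomputable section

open Set Filter MeasureTheory Metric
open scoped Topology ENNReal unitInterval

namespace Literature.Probability.Percolation

open LatticeModels RandomPlanarGeometry

/-! ### The hexagon of faces around a site -/

/-- The six neighbours of a site read off, in this order, by the six darts of the hexagon walk
`hexAround` (the outer site of each dart): `e₁, e₁ - e₀, -e₀, -e₁, e₀ - e₁, e₀`
(anticlockwise from `60°`). [folklore] -/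
def hexDir : Fin 6 → Site 2 :=
  ![Pi.single 1 1, Pi.single 1 1 - Pi.single 0 1, -Pi.single 0 1, -Pi.single 1 1,
    Pi.single 0 1 - Pi.single 1 1, Pi.single 0 1]

/-- The six faces of `𝕋` around the origin, anticlockwise from `30°`: up `0`, down `-e₀`,
up `-e₀`, down `-e₀-e₁`, up `-e₁`, down `-e₁` (Grimmett 1999, §1.6, Fig. 1.7). [folklore] -/
def hexFace₀ : Fin 6 → HexVertex :=
  ![((0 : Site 2), 0), (-Pi.single 0 1, 1), (-Pi.single 0 1, 0), (-Pi.single 0 1 - Pi.single 1 1, 1),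
    (-Pi.single 1 1, 0), (-Pi.single 1 1, 1)]

/-- Translation invariance of the honeycomb adjacency, additive form. [folklore] -/
theorem hexGraph_adj_add_iff (x a b : Site 2) (k l : Fin 2) :
    hexGraph.Adj (x + a, k) (x + b, l) ↔ hexGraph.Adj (a, k) (b, l) := by
  rw [hexGraph_adj_iff_sub, hexGraph_adj_iff_sub a b, add_sub_add_left_eq_sub]

/-- **Translation of the honeycomb lattice by a vector of `ℤ²`**, as a graph homomorphism
`(c, j) ↦ (x + c, j)`. [folklore] -/
def hexAddHom (x : Site 2) : hexGraph →g hexGraph where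
  toFun F := (x + F.1, F.2)
  map_rel' {F G} h := (hexGraph_adj_add_iff x F.1 G.1 F.2 G.2).2 h

/-- `hexAddHom x (c, j) = (x + c, j)`. [folklore] -/
@[simp] theorem hexAddHom_apply (x : Site 2) (F : HexVertex) : hexAddHom x F = (x + F.1, F.2) := rfl

/-- Translations are injective. [folklore] -/
theorem hexAddHom_injective (x : Site 2) : Function.Injective (hexAddHom x) := by
  intro F G h
  simp only [hexAddHom_apply, Prod.mk.injEq, add_right_inj] at h
  exact Prod.ext h.1 h.2

/-- The `k`-th face around the site `x`: the translate `(x + c, j)` of `hexFace₀ k = (c, j)`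
(an `abbrev`, so that `hexAround x` has the endpoints of a mapped walk syntactically). [folklore] -/
abbrev hexFace (x : Site 2) (k : Fin 6) : HexVertex := hexAddHom x (hexFace₀ k)

/-- Consecutive faces around the origin are adjacent in the honeycomb lattice. [folklore] -/
theorem hexGraph_adj_hexFace₀ : ∀ k : Fin 6, hexGraph.Adj (hexFace₀ k) (hexFace₀ (k + 1)) := by
  decide

/-- The hexagon walk around the origin: `hexFace₀ 0 → hexFace₀ 1 → ⋯ → hexFace₀ 5 → hexFace₀ 0`.
[folklore] -/
def hexAround₀ : hexGraph.Walk (hexFace₀ 0) (hexFace₀ 0) :=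
  .cons (hexGraph_adj_hexFace₀ 0) <| .cons (hexGraph_adj_hexFace₀ 1) <|
    .cons (hexGraph_adj_hexFace₀ 2) <| .cons (hexGraph_adj_hexFace₀ 3) <|
      .cons (hexGraph_adj_hexFace₀ 4) <| .cons (hexGraph_adj_hexFace₀ 5) .nil

/-- **The hexagon walk around the site `x`**: the closed walk of length `6` on the honeycomb
lattice through the six faces of `𝕋` having `x` as a vertex, anticlockwise
(`hexFace x 0 → hexFace x 1 → ⋯ → hexFace x 5 → hexFace x 0`), the translate of `hexAround₀`.
When `x` is open and its six neighbours are closed this is the interface loop around the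
singleton cluster `{x}` (Camia–Newman, CMP 268 (2006), §2). [folklore] -/
def hexAround (x : Site 2) : hexGraph.Walk (hexFace x 0) (hexFace x 0) :=
  hexAround₀.map (hexAddHom x)

/-- The base face of `hexAround x` is the up face of the cell `x`. [folklore] -/
theorem hexFace_zero (x : Site 2) : hexFace x 0 = (x, 0) := by
  simp [hexFace₀]

/-- The support of the hexagon walk around the origin. [folklore] -/
theorem support_hexAround₀ :
    hexAround₀.support = [hexFace₀ 0, hexFace₀ 1, hexFace₀ 2, hexFace₀ 3, hexFace₀ 4,
      hexFace₀ 5, hexFace₀ 0] := by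
  simp [hexAround₀]

/-- The support of the hexagon walk: the six faces around `x`, the base face repeated. [folklore] -/
theorem support_hexAround (x : Site 2) :
    (hexAround x).support = [hexFace x 0, hexFace x 1, hexFace x 2, hexFace x 3, hexFace x 4,
      hexFace x 5, hexFace x 0] := by
  rw [hexAround, SimpleGraph.Walk.support_map, support_hexAround₀]
  rfl

/-- The faces visited by the hexagon walk are the `hexFace x k`. [folklore] -/
theorem mem_support_hexAround_iff {x : Site 2} {F : HexVertex} :
    F ∈ (hexAround x).support ↔ ∃ k, hexFace x k = F := by
  rw [support_hexAround]
  simp only [List.mem_cons, List.not_mem_nil, or_false]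
  constructor
  · rintro (rfl | rfl | rfl | rfl | rfl | rfl | rfl) <;> exact ⟨_, rfl⟩
  · rintro ⟨k, rfl⟩
    fin_cases k <;> simp

/-- The darts of the hexagon walk around the origin. [folklore] -/
theorem darts_hexAround₀ : hexAround₀.darts =
    [⟨(hexFace₀ 0, hexFace₀ 1), hexGraph_adj_hexFace₀ 0⟩, ⟨(hexFace₀ 1, hexFace₀ 2), hexGraph_adj_hexFace₀ 1⟩,
      ⟨(hexFace₀ 2, hexFace₀ 3), hexGraph_adj_hexFace₀ 2⟩, ⟨(hexFace₀ 3, hexFace₀ 4), hexGraph_adj_hexFace₀ 3⟩,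
      ⟨(hexFace₀ 4, hexFace₀ 5), hexGraph_adj_hexFace₀ 4⟩, ⟨(hexFace₀ 5, hexFace₀ 0), hexGraph_adj_hexFace₀ 5⟩] := by
  simp [hexAround₀]

/-- Every dart of the hexagon walk around the origin is a step `hexFace₀ k → hexFace₀ (k + 1)`.
[folklore] -/
theorem exists_eq_of_mem_darts_hexAround₀ {d : hexGraph.Dart} (hd : d ∈ hexAround₀.darts) :
    ∃ k : Fin 6, d.toProd = (hexFace₀ k, hexFace₀ (k + 1)) := by
  rw [darts_hexAround₀] at hd
  simp only [List.mem_cons, List.not_mem_nil, or_false] at hd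
  rcases hd with rfl | rfl | rfl | rfl | rfl | rfl
  · exact ⟨0, rfl⟩
  · exact ⟨1, rfl⟩
  · exact ⟨2, rfl⟩
  · exact ⟨3, rfl⟩
  · exact ⟨4, rfl⟩
  · exact ⟨5, by decide⟩

/-- Every dart of the hexagon walk around `x` is a step `hexFace x k → hexFace x (k + 1)`.
[folklore] -/
theorem exists_eq_of_mem_darts_hexAround {x : Site 2} {d : hexGraph.Dart}
    (hd : d ∈ (hexAround x).darts) : ∃ k : Fin 6, d.toProd = (hexFace x k, hexFace x (k + 1)) := by
  rw [hexAround, SimpleGraph.Walk.darts_map, List.mem_map] at hd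
  obtain ⟨d₀, hd₀, rfl⟩ := hd
  obtain ⟨k, hk⟩ := exists_eq_of_mem_darts_hexAround₀ hd₀
  refine ⟨k, ?_⟩
  simp only [SimpleGraph.Hom.mapDart_apply, hk, Prod.map_apply]

/-- The hexagon walk around the origin is a cycle (six distinct faces). [folklore] -/
theorem isCycle_hexAround₀ : hexAround₀.IsCycle := by
  rw [SimpleGraph.Walk.isCycle_def, SimpleGraph.Walk.isTrail_def]
  decide

/-- **The hexagon walk is a cycle of the honeycomb lattice.** [folklore] -/
theorem isCycle_hexAround (x : Site 2) : (hexAround x).IsCycle :=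
  (SimpleGraph.Walk.isCycle_map_iff_of_injective (hexAddHom_injective x)).2 isCycle_hexAround₀

/-- The hexagon walk has length `6`. [folklore] -/
@[simp] theorem length_hexAround (x : Site 2) : (hexAround x).length = 6 := by
  rw [hexAround, SimpleGraph.Walk.length_map]
  rfl

/-! ### The darts of the hexagon cross the edges from the centre to its six neighbours -/

/-- The six outer directions are the six unit vectors of `𝕋`. [folklore] -/
theorem hexDir_mem (k : Fin 6) :
    hexDir k ∈ ({Pi.single 0 1, -Pi.single 0 1, Pi.single 1 1, -Pi.single 1 1, triDiag, -triDiag} :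
      Finset (Site 2)) := by
  fin_cases k <;> decide

/-- The centre and the `k`-th outer site are adjacent in `𝕋`. [folklore] -/
theorem triGraph_adj_add_hexDir (x : Site 2) (k : Fin 6) : triGraph.Adj x (x + hexDir k) := by
  have h := hexDir_mem k
  simp only [Finset.mem_insert, Finset.mem_singleton] at h
  rw [triGraph_adj_iff_eq_add]
  rcases h with h | h | h | h | h | h <;> rw [h] <;> simp

/-- **The faces of the dart `0 → hexDir k`**: left face `hexFace₀ (k + 1)`, right face
`hexFace₀ k` (Grimmett 1999, §1.6, Fig. 1.7; cf. `triFace_dir_mem`). Verified by `decide`. [folklore] -/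
theorem triFace_hexDir (k : Fin 6) :
    triFace 0 (hexDir k) (triRot60 (hexDir k)) = hexFace₀ (k + 1) ∧
      triFace 0 (hexDir k) (triRotNeg60 (hexDir k)) = hexFace₀ k := by
  fin_cases k <;> decide

/-- **The dart of `𝕋` crossed by the `k`-th step of the hexagon**: the dart `x → x + hexDir k`
has left face `hexFace x (k + 1)` and right face `hexFace x k`, i.e. the `k`-th step of
`hexAround x` keeps the centre `x` on its left and the outer site `x + hexDir k` on its right. [folklore] -/
theorem triEdgeFaces_hexDir (x : Site 2) (k : Fin 6) :
    triEdgeFaces ⟨(x, x + hexDir k), triGraph_adj_add_hexDir x k⟩ =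
      (hexFace x (k + 1), hexFace x k) := by
  obtain ⟨h1, h2⟩ := triFace_hexDir k
  show (triFace x (x + hexDir k) (x + triRot60 (x + hexDir k - x)),
    triFace x (x + hexDir k) (x + triRotNeg60 (x + hexDir k - x))) = _
  rw [add_sub_cancel_left]
  have e1 : triFace x (x + hexDir k) (x + triRot60 (hexDir k)) =
      (x + (triFace 0 (hexDir k) (triRot60 (hexDir k))).1,
        (triFace 0 (hexDir k) (triRot60 (hexDir k))).2) := by
    rw [← triFace_add, add_zero]
  have e2 : triFace x (x + hexDir k) (x + triRotNeg60 (hexDir k)) =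
      (x + (triFace 0 (hexDir k) (triRotNeg60 (hexDir k))).1,
        (triFace 0 (hexDir k) (triRotNeg60 (hexDir k))).2) := by
    rw [← triFace_add, add_zero]
  rw [e1, e2, h1, h2]
  rfl


/-! ### Isolated sites and the interface loops around them -/

/-- **`x` is an isolated open site of `ω`**: `x` is open and its six neighbours are closed. [folklore] -/
def isoOpen (x : Site 2) : Set (SiteConfig (Site 2)) := {ω | x ∈ ω ∧ ∀ k : Fin 6, x + hexDir k ∉ ω}

/-- **`x` is an isolated closed site of `ω`**: `x` is closed and its six neighbours are open. [folklore] -/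
def isoClosed (x : Site 2) : Set (SiteConfig (Site 2)) := {ω | x ∉ ω ∧ ∀ k : Fin 6, x + hexDir k ∈ ω}

/-- **The hexagon around an isolated open site is an interface loop** (open site `x` on the left
of every dart, the closed neighbour `x + hexDir k` on the right of the `k`-th dart;
Camia–Newman, CMP 268 (2006), §2: the boundary of the singleton cluster `{x}`). [folklore] -/
theorem isSiteInterfaceLoop_hexAround {ω : SiteConfig (Site 2)} {x : Site 2} (h : ω ∈ isoOpen x) :
    IsSiteInterfaceLoop ω (hexAround x) := by
  refine ⟨isCycle_hexAround x, fun d hd ↦ ?_⟩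
  obtain ⟨k, hk⟩ := exists_eq_of_mem_darts_hexAround hd
  refine ⟨⟨(x, x + hexDir k), triGraph_adj_add_hexDir x k⟩, ?_, h.1, h.2 k⟩
  rw [triEdgeFaces_hexDir, hk]

/-- **The reversed hexagon around an isolated closed site is an interface loop** (clockwise:
the open neighbours on the left, the closed centre on the right; the boundary of the closed
singleton seen from the surrounding open sites). [folklore] -/
theorem isSiteInterfaceLoop_reverse_hexAround {ω : SiteConfig (Site 2)} {x : Site 2}
    (h : ω ∈ isoClosed x) : IsSiteInterfaceLoop ω (hexAround x).reverse := by
  refine ⟨(isCycle_hexAround x).reverse, fun d hd ↦ ?_⟩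
  rw [SimpleGraph.Walk.darts_reverse, List.mem_reverse, List.mem_map] at hd
  obtain ⟨d₀, hd₀, rfl⟩ := hd
  obtain ⟨k, hk⟩ := exists_eq_of_mem_darts_hexAround hd₀
  refine ⟨SimpleGraph.Dart.symm ⟨(x, x + hexDir k), triGraph_adj_add_hexDir x k⟩, ?_, h.2 k, h.1⟩
  rw [triEdgeFaces_symm_holds, triEdgeFaces_hexDir]
  change (hexFace x k, hexFace x (k + 1)) = (d₀.toProd.swap.2, d₀.toProd.swap.1)
  rw [hk]
  rfl

/-! ### The trace of the hexagon: inside the closed `δ`-ball about the centre -/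

/-- The centres of the six faces around `x`, rescaled by `δ ≥ 0`, lie in the closed ball of
radius `δ` about the mesh point `δ x` (they are at distance `δ/√3`). [folklore] -/
theorem hexCenter_hexFace_mem_closedBall {δ : ℝ} (hδ : 0 ≤ δ) (x : Site 2) (k : Fin 6) :
    (δ : ℂ) * hexCenter (hexFace x k) ∈ closedBall (triMeshPoint δ x) δ := by
  have h := (hexCenter_triEdgeFaces_mem_closedBall hδ ⟨(x, x + hexDir k), triGraph_adj_add_hexDir x k⟩).2
  rwa [triEdgeFaces_hexDir] at h

/-- **The trace of the hexagon loop at mesh `δ ≥ 0` lies in `closedBall (δ x) δ`** (a polyline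
lies in any convex set containing its vertices). [folklore] -/
theorem range_toCurve_hexAround_subset {δ : ℝ} (hδ : 0 ≤ δ) (x : Site 2) :
    Set.range ((hexAround x).toCurve fun v ↦ (δ : ℂ) * hexCenter v) ⊆ closedBall (triMeshPoint δ x) δ := by
  refine SimpleGraph.Walk.range_toCurve_subset _ (hexCenter_hexFace_mem_closedBall hδ x 0) fun d hd ↦ ?_
  obtain ⟨k, hk⟩ := exists_eq_of_mem_darts_hexAround hd
  have h1 : d.toProd.1 = hexFace x k := by rw [hk]
  have h2 : d.toProd.2 = hexFace x (k + 1) := by rw [hk]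
  refine (convex_closedBall _ _).segment_subset ?_ ?_
  · rw [h1]; exact hexCenter_hexFace_mem_closedBall hδ x k
  · rw [h2]; exact hexCenter_hexFace_mem_closedBall hδ x (k + 1)

/-- The trace of the reversed hexagon loop at mesh `δ ≥ 0` lies in `closedBall (δ x) δ`. [folklore] -/
theorem range_toCurve_reverse_hexAround_subset {δ : ℝ} (hδ : 0 ≤ δ) (x : Site 2) :
    Set.range ((hexAround x).reverse.toCurve fun v ↦ (δ : ℂ) * hexCenter v) ⊆
      closedBall (triMeshPoint δ x) δ := by
  refine SimpleGraph.Walk.range_toCurve_subset _ (hexCenter_hexFace_mem_closedBall hδ x 0) fun d hd ↦ ?_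
  rw [SimpleGraph.Walk.darts_reverse, List.mem_reverse, List.mem_map] at hd
  obtain ⟨d₀, hd₀, rfl⟩ := hd
  obtain ⟨k, hk⟩ := exists_eq_of_mem_darts_hexAround hd₀
  have h1 : d₀.toProd.1 = hexFace x k := by rw [hk]
  have h2 : d₀.toProd.2 = hexFace x (k + 1) := by rw [hk]
  refine (convex_closedBall _ _).segment_subset ?_ ?_
  · change (δ : ℂ) * hexCenter d₀.toProd.2 ∈ _
    rw [h2]; exact hexCenter_hexFace_mem_closedBall hδ x (k + 1)
  · change (δ : ℂ) * hexCenter d₀.toProd.1 ∈ _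
    rw [h1]; exact hexCenter_hexFace_mem_closedBall hδ x k

/-! ### The type: the hexagon is anticlockwise -/

/-- **The shoelace sum is translation invariant**: consecutive cross terms change by
`g(q) - g(p)` with `g(p) = c₁ p₂ - p₁ c₂`, which telescopes around the cycle. [folklore] -/
theorem shoelace_map_const_add (c : ℂ) (l : List ℂ) : shoelace (l.map (c + ·)) = shoelace l := by
  set g : ℂ → ℝ := fun p ↦ c.re * p.im - p.re * c.im with hg
  set g' : ℂ → ℝ := fun p ↦ p.re * c.im - c.re * p.im with hg'
  have hlen : (l.rotate 1).length ≤ l.length := by rw [List.length_rotate]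
  have hlen' : l.length ≤ (l.rotate 1).length := by rw [List.length_rotate]
  unfold shoelace
  rw [← List.map_rotate, List.zip_map, List.map_map]
  have hterm : ((fun p : ℂ × ℂ ↦ p.1.re * p.2.im - p.2.re * p.1.im) ∘ Prod.map (c + ·) (c + ·)) =
      fun p : ℂ × ℂ ↦ (p.1.re * p.2.im - p.2.re * p.1.im) + ((g ∘ Prod.snd) p + (g' ∘ Prod.fst) p) := by
    funext p
    simp only [Function.comp_apply, Prod.map_fst, Prod.map_snd, Complex.add_re, Complex.add_im, hg, hg']
    ring
  have hgg' : (fun p ↦ g p + g' p) = fun _ ↦ (0 : ℝ) := by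
    funext p; simp only [hg, hg']; ring
  have e1 : List.map (g ∘ Prod.snd) (l.zip (l.rotate 1)) = List.map g (l.rotate 1) := by
    rw [← List.map_map, List.map_snd_zip hlen]
  have e2 : List.map (g' ∘ Prod.fst) (l.zip (l.rotate 1)) = List.map g' l := by
    rw [← List.map_map, List.map_fst_zip hlen']
  rw [hterm, List.sum_map_add, List.sum_map_add, e1, e2, List.map_rotate, (List.rotate_perm _ 1).sum_eq,
    ← List.sum_map_add, hgg', List.map_const', List.sum_replicate, smul_zero, add_zero]

/-- Face centres are translation covariant: `hexCenter (x + c, j) = triEmbed x + hexCenter (c, j)`.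
[folklore] -/
theorem hexCenter_add (x c : Site 2) (j : Fin 2) :
    hexCenter (x + c, j) = triEmbed x + hexCenter (c, j) := by
  simp only [hexCenter, triEmbed_add]
  ring

/-- **The shoelace sum of the hexagon around the origin is `√3`** (twice the area `√3/2` of the
hexagon of circumradius `1/√3`; positive: anticlockwise). [folklore] -/
theorem shoelace_hexAround₀ : shoelace (hexAround₀.support.map hexCenter) = Real.sqrt 3 := by
  rw [support_hexAround₀]
  simp [shoelace, hexFace₀, hexCenter, triEmbed_neg, triEmbed_sub, List.rotate_cons_succ]
  ring

/-- **The shoelace sum of the hexagon around `x` is `√3 > 0`**: `hexAround x` is traversed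
anticlockwise, i.e. it has DKKMO type `1` in `siteLoopConfig`. [folklore] -/
theorem shoelace_hexAround (x : Site 2) : shoelace ((hexAround x).support.map hexCenter) = Real.sqrt 3 := by
  have h : (hexAround x).support.map hexCenter = (hexAround₀.support.map hexCenter).map (triEmbed x + ·) := by
    rw [support_hexAround, support_hexAround₀]
    simp [hexCenter_add]
  rw [h, shoelace_map_const_add, shoelace_hexAround₀]

/-- The hexagon around `x` has positive shoelace sum (type `1`). [folklore] -/
theorem shoelace_hexAround_pos (x : Site 2) : 0 < shoelace ((hexAround x).support.map hexCenter) := by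
  rw [shoelace_hexAround]
  exact Real.sqrt_pos.2 (by norm_num)

/-- The reversed hexagon around `x` has negative shoelace sum (type `0`). [folklore] -/
theorem shoelace_reverse_hexAround_neg (x : Site 2) :
    shoelace ((hexAround x).reverse.support.map hexCenter) < 0 := by
  rw [SimpleGraph.Walk.support_reverse, List.map_reverse, shoelace_reverse, shoelace_hexAround, neg_lt_zero]
  exact Real.sqrt_pos.2 (by norm_num)

/-! ### Membership in the typed loop configuration -/

/-- **An isolated open site carries a type-`1` member of the typed loop configuration inside
`closedBall (δ x) δ`**: the unbased loop of the hexagon `hexAround x` (interface loop,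
anticlockwise). [folklore] -/
theorem exists_mem_siteLoopConfig_one_of_isoOpen {δ : ℝ} (hδ : 0 ≤ δ) {ω : SiteConfig (Site 2)}
    {x : Site 2} (h : ω ∈ isoOpen x) :
    ∃ u ∈ (siteLoopConfig δ ω).F 1, u.range ⊆ closedBall (triMeshPoint δ x) δ := by
  refine ⟨UnbasedLoop.mk (BasedLoop.mk (siteLoopCurve δ (hexAround x)) (isLoop_siteLoopCurve δ _)),
    mem_siteLoopConfig_iff.2 ⟨_, hexAround x, isSiteInterfaceLoop_hexAround h,
      ⟨fun _ ↦ shoelace_hexAround_pos x, fun _ ↦ rfl⟩, rfl⟩, ?_⟩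
  exact range_toCurve_hexAround_subset hδ x

/-- **An isolated closed site carries a type-`0` member of the typed loop configuration inside
`closedBall (δ x) δ`**: the unbased loop of the reversed hexagon (interface loop, clockwise). [folklore] -/
theorem exists_mem_siteLoopConfig_zero_of_isoClosed {δ : ℝ} (hδ : 0 ≤ δ) {ω : SiteConfig (Site 2)}
    {x : Site 2} (h : ω ∈ isoClosed x) :
    ∃ u ∈ (siteLoopConfig δ ω).F 0, u.range ⊆ closedBall (triMeshPoint δ x) δ := by
  refine ⟨UnbasedLoop.mk (BasedLoop.mk (siteLoopCurve δ (hexAround x).reverse) (isLoop_siteLoopCurve δ _)),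
    mem_siteLoopConfig_iff.2 ⟨_, (hexAround x).reverse, isSiteInterfaceLoop_reverse_hexAround h,
      ⟨fun h0 ↦ absurd h0 (by decide), fun h0 ↦ absurd h0 (lt_asymm (shoelace_reverse_hexAround_neg x))⟩,
      rfl⟩, ?_⟩
  exact range_toCurve_reverse_hexAround_subset hδ x

/-- Both types together: an isolated site of the right colour near `x` yields a member of type
`i` inside `closedBall (δ x) δ` (`i = 1`: isolated open; `i = 0`: isolated closed). [folklore] -/
theorem exists_mem_siteLoopConfig_of_iso {δ : ℝ} (hδ : 0 ≤ δ) {ω : SiteConfig (Site 2)} {x : Site 2}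
    {i : Fin 2} (h : ω ∈ if i = 1 then isoOpen x else isoClosed x) :
    ∃ u ∈ (siteLoopConfig δ ω).F i, u.range ⊆ closedBall (triMeshPoint δ x) δ := by
  fin_cases i
  · exact exists_mem_siteLoopConfig_zero_of_isoClosed hδ (by simpa using h)
  · exact exists_mem_siteLoopConfig_one_of_isoOpen hδ (by simpa using h)


/-! ### The isolated-site events: locality, symmetry, probability -/

/-- The event "an isolated site of colour `i` at `x`": `i = 1` isolated open, `i = 0` isolated
closed (the colour of the *inner* site of the hexagon loop of type `i`). [folklore] -/
def isoEvent (i : Fin 2) (x : Site 2) : Set (SiteConfig (Site 2)) := if i = 1 then isoOpen x else isoClosed x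

/-- `isoEvent 1 = isoOpen`. [folklore] -/
@[simp] theorem isoEvent_one (x : Site 2) : isoEvent 1 x = isoOpen x := rfl

/-- `isoEvent 0 = isoClosed`. [folklore] -/
@[simp] theorem isoEvent_zero (x : Site 2) : isoEvent 0 x = isoClosed x := rfl

/-- An isolated site of colour `i` at `x` yields a member of type `i` of the typed loop
configuration inside `closedBall (δ x) δ`. [folklore] -/
theorem exists_mem_siteLoopConfig_of_isoEvent {δ : ℝ} (hδ : 0 ≤ δ) {ω : SiteConfig (Site 2)} {x : Site 2}
    {i : Fin 2} (h : ω ∈ isoEvent i x) :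
    ∃ u ∈ (siteLoopConfig δ ω).F i, u.range ⊆ closedBall (triMeshPoint δ x) δ :=
  exists_mem_siteLoopConfig_of_iso hδ h

/-- **The star of `x`**: the site and its six neighbours, the sites read by `isoEvent i x`. [folklore] -/
def hexStar (x : Site 2) : Finset (Site 2) := insert x (Finset.univ.image fun k : Fin 6 ↦ x + hexDir k)

/-- `x` is in its star. [folklore] -/
theorem self_mem_hexStar (x : Site 2) : x ∈ hexStar x := Finset.mem_insert_self _ _

/-- The neighbours are in the star. [folklore] -/
theorem add_hexDir_mem_hexStar (x : Site 2) (k : Fin 6) : x + hexDir k ∈ hexStar x :=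
  Finset.mem_insert_of_mem (Finset.mem_image.2 ⟨k, Finset.mem_univ _, rfl⟩)

/-- The outer directions are nonzero. [folklore] -/
theorem hexDir_ne_zero (k : Fin 6) : hexDir k ≠ 0 := by fin_cases k <;> decide

/-- The coordinates of the outer directions are `0` or `±1`. [folklore] -/
theorem abs_hexDir_apply_le (k : Fin 6) (i : Fin 2) : |hexDir k i| ≤ 1 := by
  fin_cases k <;> fin_cases i <;> decide

/-- The sites of the star of `x` have coordinates within `1` of those of `x`. [folklore] -/
theorem abs_sub_le_one_of_mem_hexStar {x v : Site 2} (hv : v ∈ hexStar x) (i : Fin 2) : |v i - x i| ≤ 1 := by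
  rw [hexStar, Finset.mem_insert, Finset.mem_image] at hv
  rcases hv with rfl | ⟨k, -, rfl⟩
  · simp
  · simpa using abs_hexDir_apply_le k i

/-- `isoEvent i x` is determined by the star of `x`. [folklore] -/
theorem determinedBy_isoEvent (i : Fin 2) (x : Site 2) : DeterminedBy (isoEvent i x) ↑(hexStar x) := by
  rw [determinedBy_iff]
  intro ω ω' h
  have key : ∀ v ∈ hexStar x, (v ∈ ω ↔ v ∈ ω') := fun v hv ↦ by
    constructor
    · intro hω; exact ((Set.ext_iff.1 h v).1 ⟨hω, hv⟩).1
    · intro hω'; exact ((Set.ext_iff.1 h v).2 ⟨hω', hv⟩).1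
  fin_cases i
  · simp only [isoEvent_zero, isoClosed, Set.mem_setOf_eq, Fin.zero_eta]
    rw [key x (self_mem_hexStar x)]
    exact and_congr_right fun _ ↦ forall_congr' fun k ↦ key _ (add_hexDir_mem_hexStar x k)
  · simp only [isoEvent_one, isoOpen, Set.mem_setOf_eq, Fin.mk_one]
    rw [key x (self_mem_hexStar x)]
    exact and_congr_right fun _ ↦ forall_congr' fun k ↦ not_congr (key _ (add_hexDir_mem_hexStar x k))

/-- `isoEvent i x` is measurable. [folklore] -/
theorem measurableSet_isoEvent (i : Fin 2) (x : Site 2) : MeasurableSet (isoEvent i x) :=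
  (determinedBy_isoEvent i x).measurableSet_of_finset

/-- **Translation invariance**: pulling `isoEvent i x` back along the relabelling by `v ↦ x + v`
gives `isoEvent i 0`. [folklore] -/
theorem preimage_relabel_addLeft_isoEvent (i : Fin 2) (x : Site 2) :
    SiteConfig.relabel (Equiv.addLeft x) ⁻¹' isoEvent i x = isoEvent i 0 := by
  ext ω
  fin_cases i <;>
    simp [isoEvent, isoOpen, isoClosed]

/-- The isolated-site events have the same probability at every site. [folklore] -/
theorem real_isoEvent_eq (i : Fin 2) (x : Site 2) :
    (triSitePercolation half).real (isoEvent i x) = (triSitePercolation half).real (isoEvent i 0) := by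
  rw [← preimage_relabel_addLeft_isoEvent i x]
  exact (sitePercolation_real_preimage_relabel (Equiv.addLeft x) half (isoEvent i x)).symm

/-- The isolated-site events at the origin contain a cylinder event on the star of `0`. [folklore] -/
theorem cylinder_subset_isoEvent_zero (i : Fin 2) :
    {ω : SiteConfig (Site 2) | ∀ v ∈ hexStar 0, (v ∈ ω ↔ (if i = 1 then v = 0 else v ≠ 0))} ⊆ isoEvent i 0 := by
  intro ω hω
  have h0 := hω 0 (self_mem_hexStar 0)
  have hk := fun k ↦ hω (0 + hexDir k) (add_hexDir_mem_hexStar 0 k)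
  fin_cases i
  · simp only [Fin.zero_eta, isoEvent_zero, isoClosed, Set.mem_setOf_eq]
    simp only [Fin.zero_eta, zero_ne_one, ↓reduceIte, ne_eq, not_true_eq_false, iff_false,
      zero_add] at h0 hk
    exact ⟨h0, fun k ↦ by simpa [hexDir_ne_zero k] using hk k⟩
  · simp only [Fin.mk_one, isoEvent_one, isoOpen, Set.mem_setOf_eq]
    simp only [Fin.mk_one, ↓reduceIte, iff_true, zero_add] at h0 hk
    exact ⟨h0, fun k ↦ by simpa [hexDir_ne_zero k] using hk k⟩

/-- **The isolated-site events have a positive probability `c₀`, the same at every site and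
for both colours** (`c₀ = 2⁻⁷`; only positivity is used). [folklore] -/
theorem exists_pos_le_real_isoEvent :
    ∃ c : ℝ, 0 < c ∧ c ≤ 1 ∧ ∀ (i : Fin 2) (x : Site 2), c ≤ (triSitePercolation half).real (isoEvent i x) := by
  have hpos : ∀ i : Fin 2, 0 < (triSitePercolation half).real (isoEvent i 0) := fun i ↦
    (TwoArmPos.triSitePercolation_half_cylinder_pos (hexStar 0) fun v ↦ if i = 1 then v = 0 else v ≠ 0).trans_le
      (measureReal_mono (cylinder_subset_isoEvent_zero i))
  refine ⟨min ((triSitePercolation half).real (isoEvent 0 0)) ((triSitePercolation half).real (isoEvent 1 0)),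
    lt_min (hpos 0) (hpos 1), (min_le_left _ _).trans measureReal_le_one, fun i x ↦ ?_⟩
  rw [real_isoEvent_eq i x]
  obtain rfl | rfl : i = 0 ∨ i = 1 := by
    rcases Fin.exists_fin_two.1 ⟨i, rfl⟩ with h | h
    · exact Or.inl h
    · exact Or.inr h
  · exact min_le_left _ _
  · exact min_le_right _ _

/-! ### Rows of well-separated sites: independence -/

/-- The `j`-th site of the row from `a` in the direction `e₀` with spacing `3`: `a + 3j e₀`. [folklore] -/
def rowSite (a : Site 2) (j : ℕ) : Site 2 := a + Pi.single 0 (3 * (j : ℤ))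

/-- Coordinates of the row sites. [folklore] -/
theorem rowSite_apply_zero (a : Site 2) (j : ℕ) : rowSite a j 0 = a 0 + 3 * j := by simp [rowSite]

/-- Coordinates of the row sites. [folklore] -/
theorem rowSite_apply_one (a : Site 2) (j : ℕ) : rowSite a j 1 = a 1 := by simp [rowSite]

/-- The stars of distinct row sites are disjoint (spacing `3`, stars of coordinate radius `1`). [folklore] -/
theorem disjoint_hexStar_rowSite (a : Site 2) {j j' : ℕ} (h : j ≠ j') :
    Disjoint (hexStar (rowSite a j)) (hexStar (rowSite a j')) := by
  rw [Finset.disjoint_left]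
  intro v hv hv'
  have h1 := abs_sub_le_one_of_mem_hexStar hv 0
  have h2 := abs_sub_le_one_of_mem_hexStar hv' 0
  rw [rowSite_apply_zero, abs_le] at h1 h2
  have : (j : ℤ) = j' := by omega
  exact h (by exact_mod_cast this)

/-- **Independence along a row**: the probability that none of the first `N` row sites carries
an isolated site of colour `i` is at most `(1 - c₀)^N`. [folklore] -/
theorem real_iInter_compl_isoEvent_rowSite_le {c : ℝ}
    (hc : ∀ (i : Fin 2) (x : Site 2), c ≤ (triSitePercolation half).real (isoEvent i x))
    (i : Fin 2) (a : Site 2) (N : ℕ) :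
    (triSitePercolation half).real (⋂ j < N, (isoEvent i (rowSite a j))ᶜ) ≤ (1 - c) ^ N := by
  have hprod := sitePercolation_real_iInter_eq_prod (V := Site 2) half
    (Y := fun j ↦ (isoEvent i (rowSite a j))ᶜ) (F := fun j ↦ hexStar (rowSite a j)) (N := N)
    (fun j _ ↦ (determinedBy_isoEvent i _).compl) (fun j j' hjj' _ ↦ disjoint_hexStar_rowSite a hjj'.ne)
  change (sitePercolation (Site 2) half).real _ ≤ _
  rw [hprod, ← Finset.card_range N, ← Finset.prod_const, Finset.card_range]
  refine Finset.prod_le_prod (fun j _ ↦ measureReal_nonneg) fun j _ ↦ ?_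
  rw [measureReal_compl (measurableSet_isoEvent i _), probReal_univ]
  have h := hc i (rowSite a j)
  change c ≤ (sitePercolation (Site 2) half).real _ at h
  linarith


/-! ### Geometry of the rows near a point of the plane -/

/-- `triEmbed (n e₀) = n`. [folklore] -/
theorem triEmbed_single_zero_intCast (n : ℤ) : triEmbed (Pi.single 0 n : Site 2) = n := by
  simp [triEmbed]

/-- The `j`-th row site is at distance `3 j δ` from the start of the row, at mesh `δ ≥ 0`. [folklore] -/
theorem dist_triMeshPoint_rowSite {δ : ℝ} (hδ : 0 ≤ δ) (a : Site 2) (j : ℕ) :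
    dist (triMeshPoint δ (rowSite a j)) (triMeshPoint δ a) = δ * (3 * j) := by
  rw [rowSite, triMeshPoint, triMeshPoint, triEmbed_add, triEmbed_single_zero_intCast, dist_eq_norm,
    mul_add, add_sub_cancel_left, norm_mul, Complex.norm_real, Real.norm_of_nonneg hδ]
  congr 1
  rw [show ((3 * (j : ℤ) : ℤ) : ℂ) = ((3 * j : ℝ) : ℂ) by push_cast; ring, Complex.norm_real,
    Real.norm_of_nonneg (by positivity)]

/-- **The hexagons of a row stay near the point it was built for.** If `δ a` is within `0.7 δ`
of `z` and `3 N δ ≤ 3η/8`, then for `j < N` the closed `δ`-ball about the `j`-th row site lies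
in `ball z (η/2)`. [folklore] -/
theorem closedBall_rowSite_subset_ball {δ η : ℝ} (hδ : 0 < δ) {z : ℂ} {a : Site 2}
    (ha : dist z (triMeshPoint δ a) ≤ 7 / 10 * δ) {N j : ℕ} (hj : j < N) (hN : 3 * (N : ℝ) * δ ≤ 3 * η / 8) :
    closedBall (triMeshPoint δ (rowSite a j)) δ ⊆ ball z (η / 2) := by
  intro w hw
  rw [mem_closedBall] at hw
  rw [mem_ball]
  have hjN : (j : ℝ) + 1 ≤ N := by exact_mod_cast Nat.succ_le_of_lt hj
  have hrow := dist_triMeshPoint_rowSite hδ.le a j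
  calc dist w z ≤ dist w (triMeshPoint δ (rowSite a j)) + dist (triMeshPoint δ (rowSite a j)) (triMeshPoint δ a) +
        dist (triMeshPoint δ a) z := dist_triangle4 _ _ _ _
    _ ≤ δ + δ * (3 * j) + 7 / 10 * δ := by rw [hrow, dist_comm (triMeshPoint δ a)]; gcongr
    _ < η / 2 := by nlinarith

/-! ### Assembly: microscopic loops of both types are dense with high probability -/

/-- **Fixed-mesh bound.** Let `c ≤ P_{1/2}(isoEvent i x)` for all `i, x`, and let the finite set
`t` be an `η/2`-net of `closedBall 0 R₀`. Then at every mesh `δ > 0` the event "some point of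
`closedBall 0 R₀` has no loop of some type inside its `η`-ball" has probability at most
`|t| · 2 · (1 - c)^{⌊η/(8δ)⌋}`: around the lattice point nearest to each `z' ∈ t`, the
`⌊η/(8δ)⌋` row sites have disjoint stars inside `ball z' (η/2)`, and an isolated site of colour
`i` at any of them puts a hexagon loop of type `i` inside `ball z' (η/2) ⊆ ball z η` for every
`z ∈ ball z' (η/2)`. [folklore] -/
theorem measure_setOf_sparse_siteLoopConfig_le {c : ℝ}
    (hc : ∀ (i : Fin 2) (x : Site 2), c ≤ (triSitePercolation half).real (isoEvent i x)) {R₀ η : ℝ}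
    (hη : 0 < η) {t : Finset ℂ} (hcover : closedBall (0 : ℂ) R₀ ⊆ ⋃ z' ∈ t, ball z' (η / 2)) {δ : ℝ}
    (hδ : 0 < δ) :
    triSitePercolation half {ω | ∃ z ∈ closedBall (0 : ℂ) R₀, ∃ i : Fin 2,
        ∀ u ∈ (siteLoopConfig δ ω).F i, ¬ u.range ⊆ ball z η} ≤
      (t.card : ℝ≥0∞) * (2 * ENNReal.ofReal ((1 - c) ^ ⌊η / (8 * δ)⌋₊)) := by
  set N := ⌊η / (8 * δ)⌋₊ with hN
  have hNδ : 3 * (N : ℝ) * δ ≤ 3 * η / 8 := by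
    have h1 : (N : ℝ) ≤ η / (8 * δ) := Nat.floor_le (by positivity)
    rw [le_div_iff₀ (by positivity)] at h1
    nlinarith
  choose a ha using fun z' : ℂ ↦ exists_dist_triMeshPoint_le hδ z'
  set Bad : ℂ → Fin 2 → Set (SiteConfig (Site 2)) := fun z' i ↦ ⋂ j < N, (isoEvent i (rowSite (a z') j))ᶜ
    with hBad
  have hsub : {ω : SiteConfig (Site 2) | ∃ z ∈ closedBall (0 : ℂ) R₀, ∃ i : Fin 2,
      ∀ u ∈ (siteLoopConfig δ ω).F i, ¬ u.range ⊆ ball z η} ⊆ ⋃ z' ∈ t, ⋃ i : Fin 2, Bad z' i := by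
    rintro ω ⟨z, hz, i, hzi⟩
    obtain ⟨z', hz't, hzz'⟩ := mem_iUnion₂.1 (hcover hz)
    refine mem_iUnion₂.2 ⟨z', hz't, mem_iUnion.2 ⟨i, ?_⟩⟩
    by_contra hnot
    simp only [hBad, mem_iInter, mem_compl_iff, not_forall, not_not] at hnot
    obtain ⟨j, hj, hωj⟩ := hnot
    obtain ⟨u, hu, hur⟩ := exists_mem_siteLoopConfig_of_isoEvent hδ.le hωj
    refine hzi u hu (hur.trans ((closedBall_rowSite_subset_ball hδ (ha z') hj hNδ).trans ?_))
    refine ball_subset_ball' ?_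
    rw [mem_ball, dist_comm] at hzz'
    linarith
  calc triSitePercolation half {ω | ∃ z ∈ closedBall (0 : ℂ) R₀, ∃ i : Fin 2,
          ∀ u ∈ (siteLoopConfig δ ω).F i, ¬ u.range ⊆ ball z η}
      ≤ triSitePercolation half (⋃ z' ∈ t, ⋃ i : Fin 2, Bad z' i) := measure_mono hsub
    _ ≤ ∑ z' ∈ t, triSitePercolation half (⋃ i : Fin 2, Bad z' i) := measure_biUnion_finset_le t _
    _ ≤ ∑ z' ∈ t, ∑ i : Fin 2, triSitePercolation half (Bad z' i) :=
        Finset.sum_le_sum fun z' _ ↦ measure_iUnion_fintype_le _ _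
    _ ≤ ∑ z' ∈ t, ∑ i : Fin 2, ENNReal.ofReal ((1 - c) ^ N) := by
        refine Finset.sum_le_sum fun z' _ ↦ Finset.sum_le_sum fun i _ ↦ ?_
        rw [← ofReal_measureReal]
        exact ENNReal.ofReal_le_ofReal (real_iInter_compl_isoEvent_rowSite_le hc i (a z') N)
    _ = (t.card : ℝ≥0∞) * (2 * ENNReal.ofReal ((1 - c) ^ N)) := by
        rw [Finset.sum_const, Finset.sum_const, Finset.card_univ, Fintype.card_fin, nsmul_eq_mul,
          nsmul_eq_mul, Nat.cast_ofNat]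

/-- **Microscopic interface loops of both types are dense with high probability**
(Camia–Newman, CMP 268 (2006), proof of Thm 2 (ii) / §6: small loops of both orientations are
everywhere; here at the lattice level, in the elementary form "isolated open and isolated closed
sites are everywhere"). For every radius `R₀` and scale `η > 0`, the `P_{1/2}`-probability that
some point `z` of `closedBall 0 R₀` has, for some type `i`, **no** member of type `i` of the
typed loop configuration `siteLoopConfig δ ω` (DKKMO's `F_i`: interface loops of `ω` on `δ𝕋`,
type `1` = anticlockwise) with trace inside `ball z η`, tends to `0` as the mesh `δ → 0⁺`
(it is at most `|t| · 2 · (1 - c₀)^{⌊η/(8δ)⌋}` for an `η/2`-net `t` of the ball,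
`measure_setOf_sparse_siteLoopConfig_le`). This is the lattice input matching the small loops
of a continuum configuration in DKKMO's relation `d_CN ≤ ε` (`LoopConfig.IsClose`) against the
full-plane loop ensemble (`IsFullPlaneCNLLaw`, `FullPlaneCNL.lean`). [cite: CamiaNewman2006, Thm 2] -/
theorem tendsto_measure_setOf_sparse_siteLoopConfig (R₀ : ℝ) {η : ℝ} (hη : 0 < η) :
    Tendsto (fun δ : ℝ ↦ triSitePercolation half {ω | ∃ z ∈ closedBall (0 : ℂ) R₀, ∃ i : Fin 2,
        ∀ u ∈ (siteLoopConfig δ ω).F i, ¬ u.range ⊆ ball z η}) (𝓝[>] 0) (𝓝 0) := by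
  obtain ⟨c, hc0, hc1, hc⟩ := exists_pos_le_real_isoEvent
  obtain ⟨t₀, -, ht₀, hcover⟩ := finite_cover_balls_of_compact (isCompact_closedBall (0 : ℂ) R₀) (half_pos hη)
  set t := ht₀.toFinset with ht
  have hcover' : closedBall (0 : ℂ) R₀ ⊆ ⋃ z' ∈ t, ball z' (η / 2) := by
    simpa only [ht, Set.Finite.mem_toFinset] using hcover
  have hN : Tendsto (fun δ : ℝ ↦ ⌊η / (8 * δ)⌋₊) (𝓝[>] 0) atTop := by
    refine tendsto_nat_floor_atTop.comp ?_
    have h : Tendsto (fun δ : ℝ ↦ η / 8 * δ⁻¹) (𝓝[>] 0) atTop :=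
      tendsto_inv_nhdsGT_zero.const_mul_atTop (by positivity)
    refine h.congr' (Eventually.of_forall fun δ ↦ ?_)
    show η / 8 * δ⁻¹ = η / (8 * δ)
    rw [← div_div, div_eq_mul_inv (η / 8) δ]
  have hpow : Tendsto (fun δ : ℝ ↦ (1 - c) ^ ⌊η / (8 * δ)⌋₊) (𝓝[>] 0) (𝓝 0) :=
    (tendsto_pow_atTop_nhds_zero_of_lt_one (by linarith) (by linarith)).comp hN
  have hlim : Tendsto (fun δ : ℝ ↦ (t.card : ℝ≥0∞) * (2 * ENNReal.ofReal ((1 - c) ^ ⌊η / (8 * δ)⌋₊)))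
      (𝓝[>] 0) (𝓝 0) := by
    have h1 : Tendsto (fun δ : ℝ ↦ ENNReal.ofReal ((1 - c) ^ ⌊η / (8 * δ)⌋₊)) (𝓝[>] 0) (𝓝 0) := by
      simpa only [ENNReal.ofReal_zero] using ENNReal.tendsto_ofReal hpow
    have h2 := ENNReal.Tendsto.const_mul (a := 2) h1 (Or.inr ENNReal.ofNat_ne_top)
    rw [mul_zero] at h2
    have h3 := ENNReal.Tendsto.const_mul (a := (t.card : ℝ≥0∞)) h2 (Or.inr (ENNReal.natCast_ne_top t.card))
    rwa [mul_zero] at h3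
  refine tendsto_of_tendsto_of_tendsto_of_le_of_le' tendsto_const_nhds hlim
    (Eventually.of_forall fun _ ↦ bot_le) ?_
  filter_upwards [self_mem_nhdsWithin] with δ hδ
  exact measure_setOf_sparse_siteLoopConfig_le hc hη hcover' hδ

/-- `ε`-form of `tendsto_measure_setOf_sparse_siteLoopConfig`: for all small meshes the sparse
event has probability `≤ ε`. [folklore] -/
theorem eventually_measure_setOf_sparse_siteLoopConfig_le (R₀ : ℝ) {η : ℝ} (hη : 0 < η) {ε : ℝ≥0∞}
    (hε : 0 < ε) :
    ∀ᶠ δ in 𝓝[>] (0 : ℝ), triSitePercolation half {ω | ∃ z ∈ closedBall (0 : ℂ) R₀, ∃ i : Fin 2,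
        ∀ u ∈ (siteLoopConfig δ ω).F i, ¬ u.range ⊆ ball z η} ≤ ε :=
  (tendsto_order.1 (tendsto_measure_setOf_sparse_siteLoopConfig R₀ hη)).2 ε hε |>.mono fun _ h ↦ h.le

/-! ### Matching small loops: loops inside a common small ball are `d`-close -/

/-- **DKKMO's distance `d` of two unbased loops is at most the diameter of the union of their
traces** (`d ≤` oriented unbased distance `≤` based distance `≤` diameter,
`CurveClass.dist_le_diam_union`): loops inside a common small ball are close whatever their
shapes. [folklore] -/
theorem _root_.Literature.Probability.RandomPlanarGeometry.UnbasedLoop.udist_le_diam_union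
    {E : Type*} [MetricSpace E] (u v : UnbasedLoop E) : u.udist v ≤ Metric.diam (u.range ∪ v.range) := by
  obtain ⟨ℓ, rfl⟩ := UnbasedLoop.mk_surjective u
  obtain ⟨ℓ', rfl⟩ := UnbasedLoop.mk_surjective v
  refine (UnbasedLoop.udist_le_dist _ _).trans ?_
  rw [UnbasedLoop.mk, UnbasedLoop.mk, SeparationQuotient.dist_mk]
  exact (BasedLoop.dist_le_dist_toCurveClass ℓ ℓ').trans (CurveClass.dist_le_diam_union _ _)

/-- Two unbased loops with traces in a common closed ball of radius `r ≥ 0` are at `d`-distance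
`≤ 2 r`. [folklore] -/
theorem _root_.Literature.Probability.RandomPlanarGeometry.UnbasedLoop.udist_le_of_subset_closedBall
    {E : Type*} [MetricSpace E] {u v : UnbasedLoop E} {z : E} {r : ℝ} (hr : 0 ≤ r)
    (hu : u.range ⊆ closedBall z r) (hv : v.range ⊆ closedBall z r) : u.udist v ≤ 2 * r := by
  refine (UnbasedLoop.udist_le_diam_union u v).trans ?_
  refine Metric.diam_le_of_forall_dist_le (by positivity) fun p hp q hq ↦ ?_
  have hp' : p ∈ closedBall z r := (union_subset hu hv) hp
  have hq' : q ∈ closedBall z r := (union_subset hu hv) hq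
  rw [mem_closedBall] at hp' hq'
  calc dist p q ≤ dist p z + dist q z := dist_triangle_right _ _ _
    _ ≤ r + r := add_le_add hp' hq'
    _ = 2 * r := by ring

end Literature.Probability.Percolation

end
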